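import Summits.HodgeConjecture.HodgeConjecture.Theorems.Ring2AbelianAllCMJunctionFrame
import Summits.HodgeConjecture.HodgeConjecture.Theorems.Ring2AbelianAllAndreFibreClassRange
import Summits.HodgeConjecture.HodgeConjecture.Theorems.Ring2AbelianAllAndreLiftOnPath
import Summits.HodgeConjecture.HodgeConjecture.Theorems.Ring2HypothesesTwoCMPowerAnchors
import Literature.AlgebraicGeometry.Motives.AlgebraicEquivalenceFamilyFiber
import Literature.AlgebraicGeometry.Motives.AbelianVarietyProductDimProofs
import Literature.AlgebraicGeometry.Motives.CurveNet
import Literature.AlgebraicGeometry.Motives.HyperbolicWeilTypeProduct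
import Literature.AlgebraicGeometry.HodgeTheory.HodgeTypeExteriorProduct
import Literature.AlgebraicGeometry.HodgeTheory.AbelianVarietyPullbackAlgebraicClasses
import Literature.AlgebraicGeometry.HodgeTheory.IsoTransport
import Literature.AlgebraicGeometry.HodgeTheory.HodgeModelExistence
import Literature.AlgebraicGeometry.HodgeTheory.HodgeClassesProductSpanCMSquare
import Literature.AlgebraicGeometry.HodgeTheory.WeilClassesFourfoldsProofs
import Literature.AlgebraicGeometry.Milne1999.CodesHCOfCMHodgeHypothesis
import HarnessLib

/-!
# Ring 2 · sub-cell AbelianAll, André axis (seat ab-andre-1), part IV — CONSTANT PENCILS: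
# the first compact abelian pencils CONSTRUCTED in the tree, `J^{CM}` is ON-PATH (`HC_CM ⟹ J^{CM}`),
# and the unrepaired β-nodes are false outright

HONEST FRAMING (cell rule, page 1): research route, not a corollary; conditional on HC_CM plus one named
minimal statement. `HC_CM` := `Theses.RankFourFaces.CMAbelianHodge` (a BINDER, never discharged here), `HC_AV` :=
`Theses.PadicSemiregularLift.HodgeAbelianVarieties`; item `Theses.RankFourFaces.CMToAbelian` (stmt-16267) stays
OPEN. Nothing in this file is a new conjecture or a Literature fact: it CONSTRUCTS objects and PROVES implications
between nodes already displayed by parts I–III (`Ring2AbelianAllLefschetzPencils`, `…CMJunction`, `…CMJunctionFrame`)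
and by seat ab-andre-2 (`Ring2AbelianAllAndreFibreClass(Range)`, `Ring2AbelianAllFrame`).

## What is constructed (§A–§B; no hypothesis)

For a complex abelian variety `A` and a smooth projective curve `C` (`IsSmoothProjective 1 C`), the projection
`pr₂ : A × C ⟶ C` (`CartesianMonoidalCategory.snd A.X C` of `Over (Spec ℂ)`) IS a compact pencil of abelian
varieties of relative dimension `dim A` (`isCompactAbelianPencil_snd`): section `(0_A, 𝟙)`, total space smooth
projective of dimension `dim A + 1` (`IsSmoothProjective.tensor_holds`), smooth of relative dimension `dim A` and
proper by base change, and EVERY fibre charted by `A` itself through the slice `i_t = (𝟙, t) : A ≅ A × {t}`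
(`exists_sliceFiberIso`, from the cartesian slice square `Motives.isPullback_sliceAt`; an existence theorem, so
that no new definition enters `Theorems/`), with `i_t` followed by the fibre inclusion and `pr₁` equal to the
identity (`fiberι_snd_comp_fst_of_eq`), so that a class `pr₁^* w` restricts on every fibre to (the chart image of)
`w` (`complexBetti_map_fiberι_map_fst_of_eq`). With `A` of CM
type every point of `C` lies in the CM locus (`mem_cmLocus_snd`); the tree's CM elliptic curve `E₀ = ℂ/ℤ[i]`
(`CMEndomorphism.exists_cmCurve_sqrt_neg 1`) then gives, for every `d ≥ 1`, a compact abelian pencil of relative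
dimension `d` with non-empty CM locus (`exists_isCompactAbelianPencil_cmLocus_nonempty`: `E₀ᵈ × E₀ ⟶ E₀`). These are
the FIRST INHABITANTS of `Motives.IsCompactAbelianPencil` in the tree: every universal pencil node of the sub-cell
((2), (3), (4), (5), (5∀), (L), (L∀), (β′…)) quantifies over a NON-EMPTY class — the vacuity audit of those nodes is
settled (they are not true for want of pencils).

## What is proved

* §C **`J^{CM}` IS ON-PATH: `HC_CM ⟹ JunctionCM`** (`junctionCM_of_HC_CM`), hence `HC_AV ⟹ J^{CM}` and
  `HodgeConjecture ⟹ J^{CM}` (`junctionCM_of_HC_AV`, `junctionCM_of_hodgeConjecture`, Frame `onPathAV_junctionCM`).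
  Witness: for `B` CM and `c` rational of type `(p,p)`, the carrier `B' := B × B` (CM, dimension `2·dim B` — the
  junction's relative-dimension clause `2·dim A'` with `A' := B`), `g := (𝟙, 0) : B ⟶ B × B`, `w := pr₁^* c`
  (so `g^* w = c`), and the CONSTANT pencil `(B × B) × E₀ ⟶ E₀` anchored at `s₀ = s₁ =` the origin with
  `W := pr_{B×B}^* w`, chart `i_{s₀}`, `g₁ := 𝟙`, `q := 1`: clause (iii) "`W|_{s₀}` algebraic" is `w` algebraic,
  i.e. `c` algebraic — which is what `HC_CM` gives. CORRECTS part II/III's reading "no junction has an on-path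
  lemma": the abstract junction `J^{CM}` has one (by degenerate witnesses); `J^{CM,pow}` and `J^{∀E}` (anchor
  isogenous to a power of an elliptic curve) do NOT get one this way (a constant pencil through `B × B` has no
  `Eᴺ⁺¹`-fibre unless `B × B ~ Eᴺ⁺¹`), and remain the junctions with content beyond `HC_CM`.
* §D consequences, all WITHOUT `HC_CM` as a hypothesis: granted any one of (4) `CMFibreTransport`, (4′)
  `CMAnchoredTransport`, (L) `CMFibreAlgebraicLift`, (3) `CMPointedPencilVHC`, R_{6.3.1} `CMAnchoredPencilVHC`, (β′)
  `FibreClassLefschetzOnCMPointedPencils`, **`JunctionCM ↔ HC_CM`** (`junctionCM_iff_HC_CM_of_…`); and granted Lemme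
  6.3.1 (`h₂₁`), **`HC_AV ↔ (JunctionCM ∧ CMFibreTransport)`** (`HC_AV_iff_junctionCM_and_cmFibreTransport`; also with
  (4′), (L), (3)) — the sub-cell's headline `HC_CM ∧ B_min ⟹ HC_AV` with `HC_CM` REPLACED by the print-junction at no
  loss and no gain. So, as typed, `J^{CM}` is EXACTLY `HC_CM` modulo the directional node: its value in the rows of
  parts II–III is that PRINT proves it (André 1996, Lemmes 6.3.2–6.3.3 with a CM elliptic curve), not its strength.
* §E **the unrepaired β-nodes of ab-andre-2 part V/VII are FALSE outright** (andre-2's `not_…_of_pencil` /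
  `…_of_class`, part VII-bis `Ring2AbelianAllAndreFibreClassRange` §E, fed with the pencils of §B and the class `0`):
  `¬ FibreClassLefschetzCompactPencils`, `¬ FibreClassLefschetzCMPointedPencils`, `¬ FibreClassLefschetzAtRelDim d`
  (`d ≥ 1`), `¬ CMAnchoredPencilFibreClassLefschetz` — negative knowledge for the cell's table; the REPAIRED nodes
  (β∀′)/(β′)/(β∃′)/(β′)_d (`FibreClassLefschetzOn…`) are untouched and, granted `J^{CM}`, (β′) joins the CM-idle list
  (`junctionCM_iff_HC_CM_of_fibreClassLefschetzOnCMPointedPencils`, `cmIdle_fibreClassLefschetzOnCMPointedPencils_…`).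

NOT claimed: `HC_AV ⟹ (5)`/(5∀) (Tankeev 2008, untyped, text unobtainable — acq-01874); any edge into `J^{CM,pow}`,
`J^{∀E}`; (3)/(4)/(L) ON constant pencils (true — slices of a connected curve are homotopic — but not needed here).

References: Andre1996Motifs (Lemmes 6.3.1–6.3.3, Remarque 2, pp. 31–33); Milne1999 (§2 p. 54: products of CM abelian
varieties are CM); Milne2020HodgeClassesAV (Rem. 2–3); Fulton1998 (§10.1 slices `X × {t}`; §19.2 Cor. 19.2 (b));
Hartshorne1977 (II.3 fibres, III Prop. 10.1 base change of smooth morphisms); SilvermanAEC2009 (VI.4.1: `ℂ/ℤ[i]`);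
VoisinHodgeI2002 (§7.3.2 functoriality of Hodge types; §11 cycle classes); HatcherAT2002 (§3.1 p. 198).
-/

noncomputable section

set_option linter.dupNamespace false

namespace Summit.HodgeConjecture.HodgeConjecture.Ring2.AbelianAll

open CategoryTheory CategoryTheory.Limits AlgebraicGeometry MonoidalCategory
open Literature.AlgebraicGeometry Literature.AlgebraicGeometry.Motives
open Literature.AlgebraicGeometry.HodgeTheory
open Literature.AlgebraicGeometry.Milne1999 (IsOfCMType)
open Literature.AlgebraicGeometry.Andre1996 (andre1996_cmAnchoredPencil)
open Literature.NumberTheory.EllipticCurves (CMEndomorphism.exists_cmCurve_sqrt_neg)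
open Summit.HodgeConjecture.HodgeConjecture
open Summit.HodgeConjecture.HodgeConjecture.Theses
open Summit.HodgeConjecture.HodgeConjecture.Theses.RankFourFaces (CMAbelianHodge CMToAbelian)
open Summit.HodgeConjecture.HodgeConjecture.Theses.PadicSemiregularLift (HodgeAbelianVarieties)
open Summit.HodgeConjecture.HodgeConjecture.Ring2.Deform (CMPointedCompactPencilVHC CMAnchoredPencilVHC
  HC_CM_of_HC_AV HC_AV_of_hodgeConjecture)

/-! ## §A The slice chart of a constant family `pr₂ : X × C ⟶ C` (no hypothesis; theorems only) -/

section Slice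

variable (X : SchemeOver ℂ) {C : SchemeOver ℂ}

/-- **The fibre of `pr₂ : X × C ⟶ C` over `t ∈ C(ℂ)` is `X`, through the slice `i_t = (𝟙, t)`**: there is an
isomorphism `e : X ≅ (X × C)_t` over `Spec ℂ` with `e ≫ (fibre inclusion) = i_t`. The slice square
`X ⟶ X × C ⟶ C`, `X ⟶ Spec ℂ ⟶ C` is cartesian (`Motives.isPullback_sliceAt`) and the fibre is by definition the
fibre product `(X × C) ×_C Spec ℂ` (`Motives.fiberOver`); stated as an existence so that no new definition enters
`Theorems/` (the isomorphism is unique given the equation, `fiberι` being a monomorphism).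
[cite: Fulton1998, §10.1 (the slice X × {t})] [cite: Hartshorne1977, II.3 (fibre of a morphism, p. 89)] -/
theorem exists_sliceFiberIso (t : ComplexPoints C) :
    ∃ e : X ≅ fiberOver (CartesianMonoidalCategory.snd X C) t,
      e.hom ≫ fiberι (CartesianMonoidalCategory.snd X C) t = sliceAt X t := by
  refine ⟨Over.isoMk (isPullback_sliceAt (X := X) t).isoPullback ?_, ?_⟩
  · change (isPullback_sliceAt (X := X) t).isoPullback.hom ≫
        pullback.fst (CartesianMonoidalCategory.snd X C).left t.toSpecHom ≫ (X ⊗ C).hom = X.hom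
    rw [IsPullback.isoPullback_hom_fst_assoc]
    exact Over.w (sliceAt X t)
  · apply Over.OverMorphism.ext
    change (isPullback_sliceAt (X := X) t).isoPullback.hom ≫
        pullback.fst (CartesianMonoidalCategory.snd X C).left t.toSpecHom = (sliceAt X t).left
    exact (isPullback_sliceAt (X := X) t).isoPullback_hom_fst

variable {X}

/-- For a chart `e` with `e ≫ j_t = i_t`: the fibre inclusion followed by `pr₁` is `e⁻¹` (as `i_t ≫ pr₁ = 𝟙`).
[cite: Fulton1998, §10.1] -/
theorem fiberι_snd_comp_fst_of_eq {t : ComplexPoints C} {e : X ≅ fiberOver (CartesianMonoidalCategory.snd X C) t}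
    (he : e.hom ≫ fiberι (CartesianMonoidalCategory.snd X C) t = sliceAt X t) :
    fiberι (CartesianMonoidalCategory.snd X C) t ≫ CartesianMonoidalCategory.fst X C = e.inv := by
  refine (e.hom_comp_eq_id).mp ?_
  rw [← Category.assoc, he, sliceAt_fst]

/-- **Restriction of `pr₁^* w` to the fibre over `t` is `w`** (moved along the chart): `j_t^*(pr₁^* w) = (e⁻¹)^* w`
on `H^i((X × C)_t(ℂ); ℂ)`, for any chart `e` with `e ≫ j_t = i_t`. [cite: Fulton1998, §10.1] [cite: HatcherAT2002, §3.1 p. 198] -/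
theorem complexBetti_map_fiberι_map_fst_of_eq {t : ComplexPoints C}
    {e : X ≅ fiberOver (CartesianMonoidalCategory.snd X C) t}
    (he : e.hom ≫ fiberι (CartesianMonoidalCategory.snd X C) t = sliceAt X t) (i : ℕ) (w : complexBetti X i) :
    complexBetti.map (fiberι (CartesianMonoidalCategory.snd X C) t) i
        (complexBetti.map (CartesianMonoidalCategory.fst X C) i w) =
      complexBetti.map e.inv i w := by
  rw [← CategoryTheory.comp_apply, ← complexBetti.map_comp, fiberι_snd_comp_fst_of_eq he]

/-- Every fibre of `pr₂ : X × C ⟶ C` is isomorphic to `X`. [cite: Fulton1998, §10.1] -/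
theorem nonempty_iso_fiberOver_snd (X : SchemeOver ℂ) (t : ComplexPoints C) :
    Nonempty (X ≅ fiberOver (CartesianMonoidalCategory.snd X C) t) :=
  (exists_sliceFiberIso X t).elim fun e _ ↦ ⟨e⟩

end Slice

/-! ## §B Constant pencils `A × C ⟶ C` ARE compact pencils of abelian varieties; CM locus; inhabitants -/

/-- **The constant pencil `pr₂ : A × C ⟶ C` is a compact pencil of abelian varieties of relative dimension
`dim A`**, for `A` a complex abelian variety and `C` a smooth projective curve: section `(0_A, 𝟙_C)`; base `C`;
total space `A × C` smooth projective of dimension `dim A + 1` (`IsSmoothProjective.tensor_holds`); `pr₂` smooth of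
relative dimension `dim A` and proper (base change of `A → Spec ℂ`, Mathlib); every fibre `≅ A` (`exists_sliceFiberIso`).
The simplest instance of André's footnote (2) p. 31 «schéma abélien de base une courbe projective lisse».
[cite: Andre1996Motifs, §6.3 footnote (2) (p. 31)] [cite: Hartshorne1977, III Prop. 10.1 (b) and II Cor. 4.8 (c)] -/
theorem isCompactAbelianPencil_snd (A : AbelianVariety ℂ) {C : SchemeOver ℂ} (hC : IsSmoothProjective 1 C) :
    IsCompactAbelianPencil (CartesianMonoidalCategory.snd A.X C) A.dim := by
  have hA : IsSmoothProjective A.dim A.X := AbelianVariety.isSmoothProjective_holds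
  haveI : IsProper A.X.hom := A.isProper
  refine IsCompactAbelianPencil.of_section
    (CartesianMonoidalCategory.lift (toSpecOver C ≫ (1 : A.Points ℂ)) (𝟙 C))
    (CartesianMonoidalCategory.lift_snd _ _) hC (IsSmoothProjective.tensor_holds hA hC) ?_
    fun s ↦ ⟨A, nonempty_iso_fiberOver_snd A.X s⟩
  refine ⟨?_, ?_, fun s ↦ (nonempty_iso_fiberOver_snd A.X s).elim hA.of_iso⟩
  · change SmoothOfRelativeDimension A.dim (pullback.snd A.X.hom C.hom)
    haveI := smoothOfRelativeDimension_isStableUnderBaseChange (n := A.dim)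
    exact MorphismProperty.pullback_snd (P := @SmoothOfRelativeDimension A.dim) _ _ hA.smoothOfRelativeDimension
  · change IsProper (pullback.snd A.X.hom C.hom)
    infer_instance

/-- Every point of the base of the constant pencil through a CM abelian variety `A` lies in its CM locus (chart
`exists_sliceFiberIso`). [cite: Deligne1982HodgeCycles, §6 proof of Prop. 6.1 (the CM locus)] -/
theorem mem_cmLocus_snd (A : AbelianVariety ℂ) (hA : IsOfCMType A) {C : SchemeOver ℂ} (t : ComplexPoints C) :
    t ∈ Deligne1982.cmLocus (CartesianMonoidalCategory.snd A.X C) A.dim :=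
  ⟨A, nonempty_iso_fiberOver_snd A.X t, rfl, hA⟩

/-- The CM-fibre clause of the sub-cell's nodes (3), (4), (L) on a constant pencil through a CM `A`. [folklore] -/
theorem exists_cmChart_snd (A : AbelianVariety ℂ) (hA : IsOfCMType A) {C : SchemeOver ℂ} (t : ComplexPoints C) :
    ∃ A₀ : AbelianVariety ℂ, Nonempty (A₀.X ≅ fiberOver (CartesianMonoidalCategory.snd A.X C) t) ∧ IsOfCMType A₀ :=
  ⟨A, nonempty_iso_fiberOver_snd A.X t, hA⟩

/-- **Compact abelian pencils with a CM fibre EXIST in every relative dimension `d ≥ 1`**: `E₀ᵈ × E₀ ⟶ E₀` for the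
tree's CM elliptic curve `E₀ = ℂ/ℤ[i]` (`CMEndomorphism.exists_cmCurve_sqrt_neg 1`; `E₀ᵈ` is CM, Milne 1999 §2).
First inhabitants of `Motives.IsCompactAbelianPencil`. [cite: SilvermanAEC2009, Thm. VI.4.1 (b)] [cite: Milne1999, §2 p. 54] -/
theorem exists_isCompactAbelianPencil_cmLocus_nonempty (d : ℕ) (hd : 0 < d) :
    ∃ (𝒳 S : SchemeOver ℂ) (f : 𝒳 ⟶ S), IsCompactAbelianPencil f d ∧ (Deligne1982.cmLocus f d).Nonempty := by
  obtain ⟨E₀, ψ₀, hE₀, hψ₀⟩ := CMEndomorphism.exists_cmCurve_sqrt_neg 1 one_pos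
  have hE : IsSmoothProjective 1 E₀.X := isSmoothProjective_of_dim_eq' hE₀
  have hcm : IsOfCMType E₀ := isOfCMType_of_cmCurve hE₀ one_pos hψ₀
  obtain ⟨N, rfl⟩ : ∃ N, d = N + 1 := ⟨d - 1, by omega⟩
  have hdim : (E₀.powSucc N).dim = N + 1 := Hypotheses.dim_powSucc_of_dim_eq_one hE₀ N
  refine ⟨_, _, CartesianMonoidalCategory.snd (E₀.powSucc N).X E₀.X, ?_, (1 : E₀.Points ℂ), ?_⟩
  · exact hdim ▸ isCompactAbelianPencil_snd (E₀.powSucc N) hE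
  · exact hdim ▸ mem_cmLocus_snd (E₀.powSucc N) (Hypotheses.isOfCMType_powSucc hcm N) _

/-- The weaker CM-fibre clause, inhabited (relative dimension `1`: `E₀ × E₀ ⟶ E₀`). [cite: SilvermanAEC2009, Thm. VI.4.1 (b)] -/
theorem exists_isCompactAbelianPencil_cmFibre :
    ∃ (𝒳 S : SchemeOver ℂ) (f : 𝒳 ⟶ S) (d : ℕ), IsCompactAbelianPencil f d ∧
      ∃ (t : ComplexPoints S) (A₀ : AbelianVariety ℂ), Nonempty (A₀.X ≅ fiberOver f t) ∧ IsOfCMType A₀ := by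
  obtain ⟨𝒳, S, f, hf, t, A₀, he, -, hA₀⟩ := exists_isCompactAbelianPencil_cmLocus_nonempty 1 one_pos
  exact ⟨𝒳, S, f, 1, hf, t, A₀, he, hA₀⟩

/-! ## §C `J^{CM}` is ON-PATH: `HC_CM ⟹ JunctionCM` by constant pencils -/

/-- **`HC_CM ⟹ J^{CM}`.** For `B` CM (smooth projective of dimension `dim B`), `p`, and `c` rational of type
`(p,p)`: `c = g^* w` with `g := (𝟙, 0) : B ⟶ B × B`, `w := pr₁^* c`, and `w` is carried by the CM-anchored 6.3.3
pencil `pr₂ : (B × B) × E₀ ⟶ E₀` (relative dimension `2·dim B = 2·dim A'`, `A' := B`), `s₁ = s₀ :=` the origin of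
`E₀`, `W := pr_{B×B}^* w` (rational `(p,p)` on every fibre: pull-backs along morphisms of smooth projective
varieties), chart `i_{s₀} : B × B ≅` fibre (CM: `IsOfCMType.prod`), `g₁ := 𝟙`, `q := 1`, and clause (iii)
`W|_{s₀} = (i_{s₀}⁻¹)^* w` ALGEBRAIC because `w = pr₁^* c` is (`map_mem_algebraicClasses_of_abelianVariety`) once
`c` is — by `HC_CM` at the CM abelian variety `B`. So the abstract junction is NECESSARY for `HC_CM`, a fortiori for
`HC_AV`. [cite: Andre1996Motifs, Lemme 6.3.3 (ii)–(iii) (p. 33)] [cite: Milne1999, §2 p. 54]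
[cite: Fulton1998, §19.2 Cor. 19.2 (b)] [cite: VoisinHodgeI2002, §7.3.2] -/
theorem junctionCM_of_HC_CM (hCM : CMAbelianHodge) : JunctionCM := by
  intro B hB hBcm p _hp c hc hpp
  obtain ⟨E₀, ψ₀, hE₀, hψ₀⟩ := CMEndomorphism.exists_cmCurve_sqrt_neg 1 one_pos
  have hE : IsSmoothProjective 1 E₀.X := isSmoothProjective_of_dim_eq' hE₀
  -- the carrier `B' := B × B`: CM, of dimension `2·dim B`
  have hdim : (B.prod B).dim = 2 * B.dim := by rw [AbelianVariety.dim_prod, two_mul]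
  have hBB : IsSmoothProjective (2 * B.dim) (B.prod B).X := by
    rw [two_mul]; exact isSmoothProjective_prod hB hB
  have hBBcm : IsOfCMType (B.prod B) := IsOfCMType.prod hBcm hBcm
  -- the class `w := pr₁^* c` on `B × B`: rational, of type `(p,p)`, algebraic by `HC_CM`
  set w : complexBetti (B.prod B).X (2 * p) :=
    complexBetti.map (AbelianVariety.fst B B).hom.hom.hom (2 * p) c with hw
  have hwQ : IsRationalClass w := hc.pullback _
  have hwH : IsOfHodgeType (2 * B.dim) (B.prod B).X (2 * p) p p w :=
    hpp.map_of_isSmoothProjective hBB hB _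
  have hcalg : c ∈ algebraicClasses B.X p := (hCM B hB hBcm).2 p c hc hpp
  have hwalg : w ∈ algebraicClasses (B.prod B).X p :=
    map_mem_algebraicClasses_of_abelianVariety hBB B _ hcalg
  -- the constant pencil `(B × B) × E₀ ⟶ E₀`, anchored at the origin, with the global class `pr^* w`
  have hf : IsCompactAbelianPencil (CartesianMonoidalCategory.snd (B.prod B).X E₀.X) (2 * B.dim) :=
    hdim ▸ isCompactAbelianPencil_snd (B.prod B) hE
  -- the chart of the anchor fibre (over the origin `t₀` of `E₀`)
  obtain ⟨e₀, he₀⟩ := exists_sliceFiberIso (B.prod B).X (C := E₀.X) (1 : E₀.Points ℂ)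
  refine Submodule.subset_span ⟨B.prod B, AbelianVariety.prodLift (𝟙 B) 0, w, B, _, _,
    CartesianMonoidalCategory.snd (B.prod B).X E₀.X,
    ⟨hf, (1 : E₀.Points ℂ), (1 : E₀.Points ℂ),
      complexBetti.map (CartesianMonoidalCategory.fst (B.prod B).X E₀.X) (2 * p) w, B.prod B,
      e₀, 𝟙 (B.prod B), 1, fun s ↦ ?_, one_ne_zero, ?_, ?_, B.prod B, ⟨e₀⟩, hBBcm⟩, ?_⟩
  · -- `W` is rational of type `(p,p)` on every fibre (chart `e_s`)
    obtain ⟨e, he⟩ := exists_sliceFiberIso (B.prod B).X (C := E₀.X) s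
    rw [complexBetti_map_fiberι_map_fst_of_eq he]
    exact ⟨hwQ.pullback _, hwH.map_of_isSmoothProjective (hBB.of_iso e) hBB _⟩
  · -- `𝟙^* e₀^* (e₀⁻¹)^* w = 1 • w`
    rw [complexBetti_map_fiberι_map_fst_of_eq he₀, e₀.complexBetti_map_hom_map_inv]
    change complexBetti.map (𝟙 (B.prod B).X) (2 * p) w = _
    rw [complexBetti.map_id, Rat.cast_one, one_smul]
    rfl
  · -- clause (iii): `W|_{s₀}` is algebraic, because `w` is
    rw [complexBetti_map_fiberι_map_fst_of_eq he₀]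
    exact (mem_algebraicClasses_map_iff_of_iso e₀.symm).2 hwalg
  · -- `c = (𝟙, 0)^* pr₁^* c`
    rw [hw, ← CategoryTheory.comp_apply, ← complexBetti_map_comp_hom, AbelianVariety.prodLift_fst]
    change c = complexBetti.map (𝟙 B.X) (2 * p) c
    rw [complexBetti.map_id]
    rfl

/-- **`HC_AV ⟹ J^{CM}`** (`HC_AV ⟹ HC_CM`, deform II, then §C). [cite: Andre1996Motifs, Lemme 6.3.3 (p. 33)] -/
theorem junctionCM_of_HC_AV (h : HodgeAbelianVarieties) : JunctionCM :=
  junctionCM_of_HC_CM (HC_CM_of_HC_AV h)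

/-- **`HodgeConjecture ⟹ J^{CM}`**: the junction is a CASE of the summit. [cite: Andre1996Motifs, Lemme 6.3.3 (p. 33)] -/
theorem junctionCM_of_hodgeConjecture (h : _root_.HodgeConjecture) : JunctionCM :=
  junctionCM_of_HC_AV (HC_AV_of_hodgeConjecture h)

/-- Frame row: `OnPathAV JunctionCM`. [folklore] -/
theorem onPathAV_junctionCM : OnPathAV JunctionCM :=
  junctionCM_of_HC_AV

/-- Frame row: `ModCM JunctionCM` holds outright (`HC_CM → J^{CM}`). [folklore] -/
theorem modCM_junctionCM : ModCM JunctionCM :=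
  junctionCM_of_HC_CM

/-! ## §D Exactness: modulo any directional node `J^{CM} ↔ HC_CM`; modulo `h₂₁`, `HC_AV ↔ J^{CM} ∧ (4)` -/

/-- **Granted (4) `CMFibreTransport`: `JunctionCM ↔ HC_CM`** (part II `HC_CM_of_junctionCM_of_cmFibreTransport` and
§C). [cite: Andre1996Motifs, §6.3 (pp. 31–33)] -/
theorem junctionCM_iff_HC_CM_of_cmFibreTransport (hT : CMFibreTransport) : JunctionCM ↔ CMAbelianHodge :=
  ⟨fun hJ ↦ HC_CM_of_junctionCM_of_cmFibreTransport hJ hT, junctionCM_of_HC_CM⟩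

/-- Granted (4′) `CMAnchoredTransport`: `JunctionCM ↔ HC_CM`. [cite: Andre1996Motifs, §6.3 (pp. 31–33)] -/
theorem junctionCM_iff_HC_CM_of_cmAnchoredTransport (hT : CMAnchoredTransport) : JunctionCM ↔ CMAbelianHodge :=
  ⟨fun hJ ↦ HC_CM_of_junctionCM_of_cmAnchoredTransport hJ hT, junctionCM_of_HC_CM⟩

/-- Granted (L) `CMFibreAlgebraicLift`: `JunctionCM ↔ HC_CM`. [cite: Andre1996Motifs, §5.1 and §6.3 (pp. 25, 31–33)] -/
theorem junctionCM_iff_HC_CM_of_cmFibreAlgebraicLift (hL : CMFibreAlgebraicLift) : JunctionCM ↔ CMAbelianHodge :=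
  ⟨fun hJ ↦ HC_CM_of_junctionCM_of_cmFibreAlgebraicLift hJ hL, junctionCM_of_HC_CM⟩

/-- Granted (3) `CMPointedPencilVHC`: `JunctionCM ↔ HC_CM`. [cite: Andre1996Motifs, §6.3 Remarque 2 (p. 33)] -/
theorem junctionCM_iff_HC_CM_of_cmPointedPencilVHC (hV : CMPointedPencilVHC) : JunctionCM ↔ CMAbelianHodge :=
  ⟨fun hJ ↦ HC_CM_of_junctionCM_of_cmPointedPencilVHC hJ hV, junctionCM_of_HC_CM⟩

/-- Granted R_{6.3.1} `CMAnchoredPencilVHC` (deform VI): `JunctionCM ↔ HC_CM`. [cite: Andre1996Motifs, Lemme 6.3.1 (p. 32)] -/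
theorem junctionCM_iff_HC_CM_of_cmAnchoredPencilVHC (hR : CMAnchoredPencilVHC) : JunctionCM ↔ CMAbelianHodge :=
  ⟨fun hJ ↦ HC_CM_of_junctionCM_of_cmAnchoredPencilVHC hJ hR, junctionCM_of_HC_CM⟩

/-- Granted the REPAIRED β-node (β′) `FibreClassLefschetzOnCMPointedPencils` (ab-andre-2 part VII-bis):
`JunctionCM ↔ HC_CM` (through (β′) ⟹ (4′)). [cite: Abdulali1994FamiliesAV, Conjecture 5.3 and Thm. 5.5 (p. 1130)] -/
theorem junctionCM_iff_HC_CM_of_fibreClassLefschetzOnCMPointedPencils (hβ : FibreClassLefschetzOnCMPointedPencils) :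
    JunctionCM ↔ CMAbelianHodge :=
  junctionCM_iff_HC_CM_of_cmAnchoredTransport (cmAnchoredTransport_of_fibreClassLefschetzOnCMPointedPencils hβ)

/-- `HC_CM` from `J^{CM}` and (β′), NO named fact (row for the cell table: (β′) is `HC_CM`-idle modulo `J^{CM}`,
exactly as (3), (4), (L)). [cite: Abdulali1994FamiliesAV, Conjecture 5.3 (p. 1130)] [cite: Andre1996Motifs, §6.3 (pp. 31–33)] -/
theorem HC_CM_of_junctionCM_of_fibreClassLefschetzOnCMPointedPencils (hJ : JunctionCM)
    (hβ : FibreClassLefschetzOnCMPointedPencils) : CMAbelianHodge :=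
  (junctionCM_iff_HC_CM_of_fibreClassLefschetzOnCMPointedPencils hβ).1 hJ

/-- Frame row (β′): `CMIdle FibreClassLefschetzOnCMPointedPencils` modulo `h₂₁`, `J^{CM}`.
[cite: Andre1996Motifs, Lemme 6.3.1 (p. 32)] [cite: Abdulali1994FamiliesAV, Conjecture 5.3 (p. 1130)] -/
theorem cmIdle_fibreClassLefschetzOnCMPointedPencils_of_andre1996_of_junctionCM (h₂₁ : andre1996_cmAnchoredPencil)
    (hJ : JunctionCM) : CMIdle FibreClassLefschetzOnCMPointedPencils :=
  cmIdle_antitone cmAnchoredTransport_of_fibreClassLefschetzOnCMPointedPencils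
    (cmIdle_cmAnchoredTransport_of_andre1996_of_junctionCM h₂₁ hJ)

/-- **Granted Lemme 6.3.1: `HC_AV ↔ (JunctionCM ∧ CMFibreTransport)`** — the headline `HC_CM ∧ (4) ⟹ HC_AV` with
`HC_CM` replaced by the print-junction, and BOTH conjuncts on-path (`junctionCM_of_HC_AV`, part I
`cmFibreTransport_of_HC_AV`). No `HC_CM` anywhere. [cite: Andre1996Motifs, §6.3 (pp. 31–33)]
[cite: CharlesSchnell2014Notes, Cor. 11.3.6 (p. 494)] -/
theorem HC_AV_iff_junctionCM_and_cmFibreTransport (h₂₁ : andre1996_cmAnchoredPencil) :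
    HodgeAbelianVarieties ↔ (JunctionCM ∧ CMFibreTransport) :=
  ⟨fun h ↦ ⟨junctionCM_of_HC_AV h, cmFibreTransport_of_HC_AV h⟩,
    fun h ↦ HC_AV_of_andre1996_of_junctionCM_of_cmFibreTransport h₂₁ h.1 h.2⟩

/-- The same with (4′), (3) and (L) (the latter on-path from the SUMMIT only: ab-andre-2 part VI
`cmFibreAlgebraicLift_of_hodgeConjecture`, so stated as `→`). [cite: Andre1996Motifs, §6.3 (pp. 31–33)] -/
theorem HC_AV_iff_junctionCM_and_cmLocalised (h₂₁ : andre1996_cmAnchoredPencil) :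
    (HodgeAbelianVarieties ↔ (JunctionCM ∧ CMAnchoredTransport)) ∧
      (HodgeAbelianVarieties ↔ (JunctionCM ∧ CMPointedPencilVHC)) ∧
      (JunctionCM ∧ CMFibreAlgebraicLift → HodgeAbelianVarieties) :=
  ⟨⟨fun h ↦ ⟨junctionCM_of_HC_AV h, cmAnchoredTransport_of_HC_AV h⟩,
      fun h ↦ (HC_AV_iff_cmLocalised_of_andre1996_of_junctionCM h₂₁ h.1).1.2 h.2⟩,
    ⟨fun h ↦ ⟨junctionCM_of_HC_AV h, cmPointedPencilVHC_of_HC_AV h⟩,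
      fun h ↦ (HC_AV_iff_cmLocalised_of_andre1996_of_junctionCM h₂₁ h.1).2.2 h.2⟩,
    fun h ↦ HC_AV_of_andre1996_of_junctionCM_of_cmFibreAlgebraicLift h₂₁ h.1 h.2⟩

/-- **`HodgeConjecture ⟹ (JunctionCM ∧ (4) ∧ (3) ∧ (L))`**: every hypothesis of the junction rows is a case of the
summit (parts I, VI of the two André seats, and §C). [folklore] -/
theorem junctionRows_of_hodgeConjecture (h : _root_.HodgeConjecture) :
    JunctionCM ∧ CMFibreTransport ∧ CMPointedPencilVHC ∧ CMFibreAlgebraicLift :=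
  ⟨junctionCM_of_hodgeConjecture h, cmFibreTransport_of_hodgeConjecture h,
    cmPointedPencilVHC_of_HC_AV (HC_AV_of_hodgeConjecture h), cmFibreAlgebraicLift_of_hodgeConjecture h⟩

/-- `CMToAbelian` (stmt-16267) from `J^{CM}` and (4), granted `h₂₁` (part III, restated next to the exactness).
NOT a closing of the item: both hypotheses are open nodes. [cite: Andre1996Motifs, §6.3 (pp. 31–33)] -/
theorem cmToAbelian_of_andre1996_of_junctionCM_and_cmFibreTransport (h₂₁ : andre1996_cmAnchoredPencil)
    (h : JunctionCM ∧ CMFibreTransport) : CMToAbelian :=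
  fun _ A _ ↦ (HC_AV_iff_junctionCM_and_cmFibreTransport h₂₁).2 h A

/-! ## §E The unrepaired β-nodes are false outright (pencils of §B fed to ab-andre-2's refutations) -/

/-- **(β∀) `FibreClassLefschetzCompactPencils` is FALSE**: ab-andre-2's `not_fibreClassLefschetzCompactPencils_of_pencil`
(the node has no degree bound) at the constant pencil `E₀ × E₀ ⟶ E₀`. The repaired node is
`FibreClassLefschetzOnCompactPencils`. [cite: Abdulali1994FamiliesAV, Conjecture 5.3 (p. 1130)] -/
theorem not_fibreClassLefschetzCompactPencils : ¬ FibreClassLefschetzCompactPencils := by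
  obtain ⟨𝒳, S, f, hf, -⟩ := exists_isCompactAbelianPencil_cmLocus_nonempty 1 one_pos
  exact not_fibreClassLefschetzCompactPencils_of_pencil hf

/-- **(β) `FibreClassLefschetzCMPointedPencils` is FALSE** (same witness, which is CM-pointed). The repaired node is
`FibreClassLefschetzOnCMPointedPencils`. [cite: Abdulali1994FamiliesAV, Conjecture 5.3 (p. 1130)] -/
theorem not_fibreClassLefschetzCMPointedPencils : ¬ FibreClassLefschetzCMPointedPencils := by
  obtain ⟨𝒳, S, f, hf, hcm⟩ := exists_isCompactAbelianPencil_cmLocus_nonempty 1 one_pos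
  exact not_fibreClassLefschetzCMPointedPencils_of_pencil hf hcm

/-- **(β)_d `FibreClassLefschetzAtRelDim d` is FALSE for every `d ≥ 1`** (witness `E₀ᵈ × E₀ ⟶ E₀`). The repaired node
is `FibreClassLefschetzOnAtRelDim d`. [cite: Abdulali1994FamiliesAV, Conjecture 5.3 (p. 1130)] -/
theorem not_fibreClassLefschetzAtRelDim {d : ℕ} (hd : 0 < d) : ¬ FibreClassLefschetzAtRelDim d := by
  obtain ⟨𝒳, S, f, hf, hcm⟩ := exists_isCompactAbelianPencil_cmLocus_nonempty d hd
  exact not_fibreClassLefschetzAtRelDim_of_pencil hf hcm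

/-- The relative-dimension-one instance, unconditionally: (β)₁ is false (witness `E₀ × E₀ ⟶ E₀`); and there is
NO `d ≥ 1` at which the unrepaired node holds. [cite: Abdulali1994FamiliesAV, Conjecture 5.3 (p. 1130)] -/
theorem not_fibreClassLefschetzAtRelDim_one : ¬ FibreClassLefschetzAtRelDim 1 :=
  not_fibreClassLefschetzAtRelDim one_pos

/-- No positive relative dimension rescues the unrepaired node. [cite: Abdulali1994FamiliesAV, Conjecture 5.3 (p. 1130)] -/
theorem not_exists_fibreClassLefschetzAtRelDim_pos : ¬ ∃ d, 0 < d ∧ FibreClassLefschetzAtRelDim d :=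
  fun ⟨_, hd, h⟩ ↦ not_fibreClassLefschetzAtRelDim hd h

/-- **(β∃) `CMAnchoredPencilFibreClassLefschetz` is FALSE**: ab-andre-2's `not_cmAnchoredPencilFibreClassLefschetz_of_class`
at the class `0 ∈ H²(E₀(ℂ); ℂ)` (rational; of type `(1,1)` by `isOfHodgeType_zero_of_isSmoothProjective`). The
repaired node is `CMAnchoredPencilFibreClassLefschetzOn`. [cite: Abdulali1994FamiliesAV, Conjecture 5.3 (p. 1130)] -/
theorem not_cmAnchoredPencilFibreClassLefschetz : ¬ CMAnchoredPencilFibreClassLefschetz := by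
  obtain ⟨E₀, ψ₀, hE₀, -⟩ := CMEndomorphism.exists_cmCurve_sqrt_neg 1 one_pos
  have hE : IsSmoothProjective E₀.dim E₀.X := AbelianVariety.isSmoothProjective_holds
  exact not_cmAnchoredPencilFibreClassLefschetz_of_class E₀ hE 1 0 IsRationalClass.zero
    (isOfHodgeType_zero_of_isSmoothProjective nonempty_hodgeModel_holds hE _ _ _)

end Summit.HodgeConjecture.HodgeConjecture.Ring2.AbelianAll

end
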